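import Summits.QuantumFields.YangMills.Theorems.InfiniteVolumePermutations
import Summits.QuantumFields.YangMills.Theorems.BalabanLadderInfVolCeilingsDefs
import HarnessLib

/-!
# Route `InfiniteVolumeContinuum`, supports `IVEuclideanInvariance` (stmt-QuantumFields-19933) / `IVData` (19931):
# E3 of the assembled family from the DATA clause

Lead seat `ym-infvol-p1` (R136 (i)); helper W0 of the registered skeleton of `IVEuclideanInvariance`
(`IVEuclideanInvariance_proof`, stubs `stub_ivSigned` / `stub_ivDensity` / `stub_ivGerm`).  HONEST FRAMING: existence half
only, conditional on Track A's `BalabanLadder.UV`; nothing about Yang–Mills is asserted here; not a gap, not Clay.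

`isSymmetric_of_ivData`: for ANY tuple `(β, μ, S₁, T)` satisfying the DATA clause of record of the route (conventions
`S₁ 0 = ev`, `S₁ 1 = 0`, `S₁ n = Σ_{q valid} T n q` for `n ≥ 2`, and convergence on `⁰𝒮` of the plaquette-CENTRE-smeared
infinite-volume plane-string series to `T n q`), the one-field family `S₁.toLabelled` is SYMMETRIC (E3): for `n ≥ 2` this
is seat p2's exact lattice symmetry of the string-sum functional under simultaneous permutation of the string entries
(`InfiniteVolume.sum_limit_permTest_eq`, Theorems/InfiniteVolumePermutations.lean), for `n = 0, 1` the conventions.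
It is the E3 input of the spine's locality theorem `Sketch.stub_locality` in the E1 chain of `IVEuclideanInvariance`, and
the `IsSymmetric` conjunct of `IVData` for arbitrary data.

References: K. Osterwalder, R. Schrader, CMP 31 (1973) §3 (E3).

Re-homed 2026-08-26 (g2): the import of the route file `Theses.InfiniteVolumeContinuum` is dropped (the theorem never
used it), so that this module survives re-typings of the spine's `ROT` / of the route's `closes` and can be imported by
Theses-free files (the class-local E1 file `InfiniteVolumeContinuumIVEuclideanInvarianceOn`).  Declaration unchanged.
-/

set_option autoImplicit false

noncomputable section

open MeasureTheory Filter Topology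
open scoped BigOperators SchwartzMap
open Literature.MathematicalPhysics.QuantumFieldTheory hiding ZdEdge
open Literature.MathematicalPhysics.QuantumLattice
open Literature.MathematicalPhysics.AQFT
open Literature.Probability.LatticeModels (Site)
open Summit.QuantumFields.YangMills.Cruxes.OSLegsFromFemtoAndGap.DlrCollarTransfer

namespace Summit.QuantumFields.YangMills.Theorems.InfiniteVolume.E1

variable {G : Type} [Group G] [TopologicalSpace G] [IsTopologicalGroup G] [CompactSpace G]
  [MeasurableSpace G] [BorelSpace G]

omit [IsTopologicalGroup G] [CompactSpace G] [BorelSpace G] in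
/-- **E3 of the assembled family from the DATA clause**: for `n ≥ 2` by seat p2's exact lattice symmetry of the
centre-smeared string-sum functional (`sum_limit_permTest_eq`); arities `0`, `1` by the conventions. [folklore] -/
theorem isSymmetric_of_ivData (r : LatticeRep G) (a : ℝ → ℝ) (β : ℕ → ℝ) (μ : ℕ → Measure (LGConfig 4 G))
    (S₁ : SchwingerFamily (EuclideanSpace ℝ (Fin 4))) (T : (n : ℕ) → (Fin n → Fin 4 × Fin 4) → (𝓢((Fin n → EuclideanSpace ℝ (Fin 4)), ℂ) →L[ℂ] ℂ))
    (h0 : ∀ F : 𝓢((Fin 0 → EuclideanSpace ℝ (Fin 4)), ℂ), S₁ 0 F = F default) (h1 : ∀ F : 𝓢((Fin 1 → EuclideanSpace ℝ (Fin 4)), ℂ), S₁ 1 F = 0)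
    (hS : ∀ n : ℕ, 2 ≤ n → ∀ F : 𝓢((Fin n → EuclideanSpace ℝ (Fin 4)), ℂ), S₁ n F = ∑ q ∈ Fintype.piFinset (fun _ : Fin n => Finset.univ.filter fun p : Fin 4 × Fin 4 => p.1 < p.2), T n q F)
    (hT : ∀ n : ℕ, 2 ≤ n → ∀ q : Fin n → Fin 4 × Fin 4, (∀ i, (q i).1 < (q i).2) →
      ∀ F : 𝓢((Fin n → EuclideanSpace ℝ (Fin 4)), ℂ), IsOffDiagonal F →
        Tendsto (fun k => ∑' x : Fin n → (Fin 4 → ℤ), ((stateMomentStr G r (μ k) n q x : ℝ) : ℂ) *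
          F (fun l => a (β k) • siteToE (x l) + (a (β k) / 2) •
            (EuclideanSpace.single (q l).1 (1 : ℝ) + EuclideanSpace.single (q l).2 (1 : ℝ)))) atTop (𝓝 (T n q F))) :
    S₁.toLabelled.IsSymmetric := by
  intro n k π F hF
  simp only [SchwingerFamily.toLabelled_apply]
  rcases Nat.lt_or_ge n 2 with hn | hn
  · interval_cases n
    · rw [h0, h0, permTest_apply]
      exact congrArg F (Subsingleton.elim _ _)
    · rw [h1, h1]
  · rw [hS n hn _, hS n hn F]
    exact sum_limit_permTest_eq r μ (fun k => a (β k))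
      (fun k q => (a (β k) / 2) • (EuclideanSpace.single q.1 (1 : ℝ) + EuclideanSpace.single q.2 (1 : ℝ)))
      (fun q F => T n q F) (fun q hq F hF => hT n hn q hq F hF) π F hF


end Summit.QuantumFields.YangMills.Theorems.InfiniteVolume.E1

end
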